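import Summits.BirchSwinnertonDyer.BirchSwinnertonDyer.Theorems.QuadraticBranchSignedControlPlusEtaNonsurjRankLeOneOf
import Summits.BirchSwinnertonDyer.BirchSwinnertonDyer.Theorems.QuadraticBranchSignedControlPlusEtaNonsurjRowPartner
import HarnessLib

/-!
# Route `QuadraticBranchSignedControl` (rung K8, cell `bsd-potss`), crux stmt-BirchSwinnertonDyer-19606
# `PlusEtaMainConjectureNonsurj`: Part LVI — THE v10-SHAPE `_of`: CONJECTURE (A) LEAVES THE RANK-ONE CM PARTNERS. The crux BY
# NAME (and its rank-≤1 face) from v9's cite facts + the route items (C2_η-GZ) `PAdicGrossZagierBranch` and KO 1.3 + bsd.S28 +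
# **O10 in leaf currency** (`MissingPPartAt` on the CM Gss2 pairs of analytic rank one) + (A) ONLY on the CM partners of analytic
# rank ≥ 2 + analytic μ on the CM rows + the uncongruent stub

WHY. Skeleton v7/v8 route every CM row through (A) + analytic `μ` (k8eta-c2 g7); Part LI (g34) removed (A) from the partners with
`L(W,1) ≠ 0` (print road, k8q-c2 g3). Part LIV §2 (this seat) gives the node on a CM row whose partner has `r_an(W) = 1` from
**O10** (`MissingPPartAt W p`, the leaf's own clause) + Burungale–Tian 2.6η + Kobayashi 2.2η + (R2⁻) (Kitajima–Otsuki) + the route's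
(C2_η-GZ) item + Poitou–Tate (a tree theorem) — k8q-c2 g4's road fed through the row ⟹ pair dictionary. So (A) is needed only on the
CM partners with `r_an(W) ≥ 2`, i.e. exactly on the rows the rank-≤1 face DROPS — except through congruence ANCHORS: a non-CM row
congruent to a CM row `V″` inherits the node from `V″`, whose partner may have any rank, so the class-wide weak `_of` still displays
(A) on rank-≥2 CM partners (in-table every one of the 30 non-CM rows has a CM anchor whose partner has `r_an ≤ 1` — k8eta-c2 g8,
`K8-CM-UNIT-ANCHORS`: 14 rows at the unit anchors `900b1/3600bb1/10800cj1/11025e1/14400cz1` (`r_an = 0`), 16 at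
`2700p1/675a1/14400l1/11025b1` (`r_an = 1`) — so IN-TABLE the rank-≤1 face consumes no instance of (A) at all).

* §1 `etaMC_cmRows_of_print_of_cmRankOneBSDp_of_conjARankTwo_of_analyticMu` — (C1⁺_η) on EVERY CM row: partner `r_an = 0` print
  (k8q-c2 g3), `r_an = 1` O10 road (Part LIV §2), `r_an ≥ 2` (A) + analytic `μ` (k8eta-c2 g7).
* §2 **`plusEtaMainConjectureNonsurj_of_cmRankOneBSDp_of_conjARankTwo_of_analyticMu_of_uncongruent_of_citeFacts45`** — the CRUX BY NAME
  (v10-shape `_of`): Part LI §9 with §1 as its CM branch.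
* §3 **`plusEtaMainConjectureNonsurjRankLeOne_of_cmRankOneBSDp_of_conjARankTwo_of_analyticMu_of_uncongruentRankLeOne_of_citeFacts45`** —
  the rank-≤1 face (the (570)(B) weak statement) from the same inputs with the uncongruent stub restricted.

HONEST FRAMING (cell `bsd-potss`, run/shared/lean/pub/bsd-potss/; FULL-BSD rank ≤ 1 programme, HUMAN RULING D-0036/D-0074):
COMPOSITION THEOREMS ONLY — no definition, no new named fact, no `sorry`, axioms standard; CONDITIONAL on the displayed named facts
(hypothesis position; Poitou–Tate alone is discharged by the tree) and on the displayed OPEN inputs: O10 (not in print), (A) on CM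
partners of analytic rank ≥ 2, analytic `μ = 0` on CM rows, (C1⁺_η) on uncongruent non-CM rows, and the route items `PAdicGrossZagierBranch`
(crux 19116, open) and KO 1.3 (cite). No stub of 19606 is closed or re-registered (planner's act); nothing is booked; `BSD(W, p)` is
claimed for no pair. Seat `bsd-potss-k8eta-c2` g35 (prover), `--supports stmt-BirchSwinnertonDyer-19606`.

References: [BurungaleTian2026] Thm. 2.6, Rem. 2.7; [Kobayashi2003] Thm. 2.2 (p. 5), §4 + Thm. 4.1 (p. 8), Thm. 6.2–7.3, Cor. 7.2, Thm. 7.4;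
[KitajimaOtsuki2018] Main Thm. 1.3; [BurungaleFlach2024] Thm 1.1, Cor. 2; [HatleyLei2019] Thm. 4.6, Prop. 5.1; [CorpuzLei2025] Thm. 4.5;
[GreenbergVatsal2000] §3 Rem. 3.4; [CoatesSujatha2005] §3 statement (A); [Miller2011LMS] Def. 1.1.
-/

set_option autoImplicit false
set_option linter.dupNamespace false

noncomputable section

open scoped Classical

open CongruenceSubgroup Field NumberField IsDedekindDomain WeierstrassCurve
open Literature.NumberTheory.EllipticCurves
open Literature.NumberTheory.EllipticCurves.ModularForms
open Literature.NumberTheory.EllipticCurves.Rank1Residual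
open Literature.NumberTheory.EllipticCurves.Rank1Residual.Typed
open Literature.NumberTheory.GaloisRepresentations
open Literature.NumberTheory.GaloisCohomology
open Literature.NumberTheory.EllipticCurves.IwasawaAlgebra
open Literature.NumberTheory.EllipticCurves.GreenbergVatsal2000
open ZpExtension
open Summit.BirchSwinnertonDyer.Rank1Residual.Additive
open Summit.BirchSwinnertonDyer.Rank1Residual.O6 (ModPCongruent)
open Summit.BirchSwinnertonDyer.BirchSwinnertonDyer.Theses.QuadraticBranchSignedControl

namespace Summit.BirchSwinnertonDyer.BirchSwinnertonDyer.Theorems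

namespace EtaRankLeOneOfO10

/-! ## §1 The CM branch: print / O10 / (A)+μ according to the partner's analytic rank -/

/-- **(C1⁺_η) on EVERY CM row of the crux, with (A) displayed ONLY on the CM partners of analytic rank `≥ 2`.** GRANTED the named facts
`h26` (Burungale–Tian 2.6η ∘ Kob), `h22`, `h6273` (Kobayashi 2.2η, 6.2–7.3η), `hmod`, `hGZK`, `hKO` (Kitajima–Otsuki 1.3η), `hS28` (bsd.S28), the
route item `h₄ : PAdicGrossZagierBranch` ((C2_η-GZ), `δ = 0`), **O10** (`hO10`: `MissingPPartAt` on CM Gss2 pairs with `r_an = 1`, `p ≥ 5`),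
(A) on the CM partners with `2 ≤ r_an(W)` (`hAcm2`), and analytic `μ = 0` on the CM rows (`hμcm`, v7's stub text): on a CM row
`V = C • W^{(p*)}` — `r_an(W) ≤ 1`: Part LIV §2 (`EtaRowPartner.etaCMRankLeOne_of_cmRankOneBSDp`: print at rank 0, O10 road at rank 1;
Poitou–Tate from the tree theorem); `r_an(W) ≥ 2`: k8eta-c2 g7's `EtaFineRoad.etaMC_cmRows_of_bt26_of_conjA_of_analyticMu`.
CONDITIONAL; nothing booked. [cite: BurungaleTian2026, Thm. 2.6] [cite: Kobayashi2003, Thm. 2.2 (p. 5), Thm. 6.2–7.3, Cor. 7.2, Thm. 7.4]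
[cite: KitajimaOtsuki2018, Main Thm. 1.3] [cite: BurungaleFlach2024, Cor. 2] [cite: CoatesSujatha2005, §3 statement (A)] [cite: Miller2011LMS, Def. 1.1] -/
theorem etaMC_cmRows_of_print_of_cmRankOneBSDp_of_conjARankTwo_of_analyticMu
    (h26 : BurungaleTian2026.thm26_etaKatoSequences_charIdeal_upToP_of_cm)
    (h22 : Kobayashi2003.thm22_etaSignedSelmerDual_finite_torsion)
    (h6273 : Kobayashi2003.thm62_63_73_etaColemanPoitouTate)
    (hmod : hasEntireLFunction_rat) (hGZK : rank_eq_analyticRank_of_analyticRank_le_one)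
    (hKO : KitajimaOtsuki2018.mainThm13_etaSignedSelmerDual_noFiniteSubmodule)
    (hS28 : bsdTriple_of_hasCM_of_L_one_ne_zero) (h₄ : PAdicGrossZagierBranch)
    (hO10 : ∀ (W : WeierstrassCurve ℚ) [W.IsElliptic] [W.IsGloballyMinimal] (p : ℕ) [Fact p.Prime],
      W.HasCM → W.analyticRank = 1 → 5 ≤ p → Addv W p → SubGss W p → MissingPPartAt W p)
    (hAcm2 : ∀ (V : WeierstrassCurve ℚ) [V.IsElliptic] [V.IsGloballyMinimal] (W : WeierstrassCurve ℚ) [W.IsElliptic]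
        [W.IsGloballyMinimal] (C : VariableChange ℚ) (p : ℕ) [Fact p.Prime],
        5 ≤ p → C • W.quadraticTwist ((-1) ^ (p / 2) * p) = V →
        V.HasGoodReductionAtPrime p → V.frobeniusTrace p = 0 →
        ¬ (∀ m : ℕ, V.HasSurjectiveModNGaloisRep (p ^ m : ℕ)) → V.HasCM → 2 ≤ W.analyticRank →
        ∀ (κ : ZpExtension ℚ p), κ.IsCyclotomic →
          ∃ (γ : absoluteGaloisGroup ℚ) (D : W.FineSelmerDualData κ γ),
            Module.Finite ℤ_[p] (RestrictScalars ℤ_[p] (IwasawaAlgebra p) D.X))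
    (hμcm : ∀ (V : WeierstrassCurve ℚ) [V.IsElliptic] [V.IsGloballyMinimal] (p : ℕ) [Fact p.Prime],
        5 ≤ p → V.HasGoodReductionAtPrime p → V.frobeniusTrace p = 0 →
        ¬ (∀ m : ℕ, V.HasSurjectiveModNGaloisRep (p ^ m : ℕ)) → V.HasCM →
        ∀ {N : ℕ} [NeZero N] {f : CuspForm (Gamma0 N) 2}, IsNewformOf V f →
          ∀ (ϖ : ℚ), (if Even (p / 2) then (ϖ : ℝ) * V.realPeriodRat = plusPeriod f
              else (ϖ : ℝ) * V.imaginaryPeriodRat = minusPeriod f) →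
          ∀ (Lη : IwasawaAlgebra p), IsQuadraticBranchPlusLFunction f p ϖ Lη → HasUnitContent Lη) :
    ∀ (V : WeierstrassCurve ℚ) [V.IsElliptic] [V.IsGloballyMinimal] (p : ℕ) [Fact p.Prime],
      5 ≤ p → V.HasGoodReductionAtPrime p → V.frobeniusTrace p = 0 →
      ¬ (∀ m : ℕ, V.HasSurjectiveModNGaloisRep (p ^ m : ℕ)) → V.HasCM →
        QuadraticBranchPlusEtaMainConjectureAt V p := by
  intro V _ _ p _ hp5 hgood hap hns hCM
  obtain ⟨W, _, _, C, hCV⟩ := TwistPartner.exists_isGloballyMinimal_pStarPartner V p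
  by_cases h2 : 2 ≤ W.analyticRank
  · -- analytic rank ≥ 2 at the partner: g7's (A) + analytic-μ road at the row
    exact EtaFineRoad.etaMC_cmRows_of_bt26_of_conjA_of_analyticMu h26 h22 h6273 V p hp5 hgood hap hns hCM W C hCV
      (hAcm2 V W C p hp5 hCV hgood hap hns hCM h2) (hμcm V p hp5 hgood hap hns hCM)
  · -- analytic rank ≤ 1 at the partner: print (rank 0) / O10 road (rank 1), Part LIV §2; Poitou–Tate a tree theorem
    exact EtaRowPartner.etaCMRankLeOne_of_cmRankOneBSDp h26 h22
      (SchneiderFreeAdditiveX3.PoitouTateReduction.poitouTate_selmerStructure_duality_real_holds ℚ) hmod hGZK hKO hS28 h₄ hO10 V p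
      hp5 hgood hap hns hCM ⟨W, ‹_›, ‹_›, C, hCV, by omega⟩

/-! ## §2 The crux BY NAME: the v10-shape `_of` -/

/-- **THE CRUX `PlusEtaMainConjectureNonsurj` FROM v9's CITE FACTS + (C2_η-GZ) + KO 1.3 + bsd.S28 + O10 + (A) ON THE CM PARTNERS OF ANALYTIC RANK
≥ 2 + ANALYTIC μ ON THE CM ROWS + THE UNCONGRUENT STUB** (v10-shape `_of`). Part LI §9 (`h53` derived from `h45` by Part LII) with its CM branch
replaced by §1: CM rows by §1; non-CM rows congruent to a CM row from §1 at the anchor + the λ-transfer from cite facts (Part XLVIII §141);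
uncongruent non-CM rows from v7's stub text (`huncong`). CONDITIONAL on every displayed input (named facts in hypothesis position; O10, (A) on
rank-≥2 CM partners, analytic μ, the uncongruent stub and the route item 19116 OPEN); closes nothing by itself; nothing booked.
[cite: Kobayashi2003, Thm. 2.2 (p. 5), §4 + Thm. 4.1 (p. 8), Thm. 6.2–7.3, Cor. 7.2] [cite: BurungaleTian2026, Thm. 2.6]
[cite: HatleyLei2019, Thm. 4.6, Prop. 5.1] [cite: CorpuzLei2025, Thm. 4.5] [cite: GreenbergVatsal2000, §3 Rem. 3.4]
[cite: KitajimaOtsuki2018, Main Thm. 1.3] [cite: BurungaleFlach2024, Cor. 2] [cite: CoatesSujatha2005, §3 statement (A)] [cite: Miller2011LMS, Def. 1.1] -/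
theorem plusEtaMainConjectureNonsurj_of_cmRankOneBSDp_of_conjARankTwo_of_analyticMu_of_uncongruent_of_citeFacts45
    (h22 : Kobayashi2003.thm22_etaSignedSelmerDual_finite_torsion)
    (h6273 : Kobayashi2003.thm62_63_73_etaColemanPoitouTate)
    (h26 : BurungaleTian2026.thm26_etaKatoSequences_charIdeal_upToP_of_cm)
    (h46 : HatleyLei2019.thm46_prop51_etaSignedMuLambda_transfer_of_torsionIso)
    (h45 : CorpuzLei2025.thm45_etaPlusImprimitive_congruence_of_torsionIso)
    (h41 : Kobayashi2003.thm41_plusEtaCharIdeal_dvd)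
    (hnf : exists_isNewformOf) (hGV : realPeriodRat_eq_unit_mul_plusPeriod)
    (hGVm : numRealComponents_mul_imaginaryPeriodRat_eq_unit_mul_minusPeriod_of_odd)
    (hmod : hasEntireLFunction_rat) (hGZK : rank_eq_analyticRank_of_analyticRank_le_one)
    (hKO : KitajimaOtsuki2018.mainThm13_etaSignedSelmerDual_noFiniteSubmodule)
    (hS28 : bsdTriple_of_hasCM_of_L_one_ne_zero) (h₄ : PAdicGrossZagierBranch)
    (hO10 : ∀ (W : WeierstrassCurve ℚ) [W.IsElliptic] [W.IsGloballyMinimal] (p : ℕ) [Fact p.Prime],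
      W.HasCM → W.analyticRank = 1 → 5 ≤ p → Addv W p → SubGss W p → MissingPPartAt W p)
    (hAcm2 : ∀ (V : WeierstrassCurve ℚ) [V.IsElliptic] [V.IsGloballyMinimal] (W : WeierstrassCurve ℚ) [W.IsElliptic]
        [W.IsGloballyMinimal] (C : VariableChange ℚ) (p : ℕ) [Fact p.Prime],
        5 ≤ p → C • W.quadraticTwist ((-1) ^ (p / 2) * p) = V →
        V.HasGoodReductionAtPrime p → V.frobeniusTrace p = 0 →
        ¬ (∀ m : ℕ, V.HasSurjectiveModNGaloisRep (p ^ m : ℕ)) → V.HasCM → 2 ≤ W.analyticRank →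
        ∀ (κ : ZpExtension ℚ p), κ.IsCyclotomic →
          ∃ (γ : absoluteGaloisGroup ℚ) (D : W.FineSelmerDualData κ γ),
            Module.Finite ℤ_[p] (RestrictScalars ℤ_[p] (IwasawaAlgebra p) D.X))
    (hμcm : ∀ (V : WeierstrassCurve ℚ) [V.IsElliptic] [V.IsGloballyMinimal] (p : ℕ) [Fact p.Prime],
        5 ≤ p → V.HasGoodReductionAtPrime p → V.frobeniusTrace p = 0 →
        ¬ (∀ m : ℕ, V.HasSurjectiveModNGaloisRep (p ^ m : ℕ)) → V.HasCM →
        ∀ {N : ℕ} [NeZero N] {f : CuspForm (Gamma0 N) 2}, IsNewformOf V f →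
          ∀ (ϖ : ℚ), (if Even (p / 2) then (ϖ : ℝ) * V.realPeriodRat = plusPeriod f
              else (ϖ : ℝ) * V.imaginaryPeriodRat = minusPeriod f) →
          ∀ (Lη : IwasawaAlgebra p), IsQuadraticBranchPlusLFunction f p ϖ Lη → HasUnitContent Lη)
    (huncong : ∀ (V : WeierstrassCurve ℚ) [V.IsElliptic] [V.IsGloballyMinimal] (p : ℕ) [Fact p.Prime],
        5 ≤ p → V.HasGoodReductionAtPrime p → V.frobeniusTrace p = 0 →
        ¬ (∀ m : ℕ, V.HasSurjectiveModNGaloisRep (p ^ m : ℕ)) → ¬ V.HasCM →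
        ¬ (∃ (V'' : WeierstrassCurve ℚ) (_ : V''.IsElliptic) (_ : V''.IsGloballyMinimal),
            V''.HasCM ∧ V''.HasGoodReductionAtPrime p ∧ V''.frobeniusTrace p = 0 ∧ ModPCongruent V'' V p) →
        QuadraticBranchPlusEtaMainConjectureAt V p) :
    PlusEtaMainConjectureNonsurj := by
  intro V _ _ p _ hp5 hgood hap hns
  have hp2 : p ≠ 2 := by omega
  -- the CM branch (§1)
  have hcmRows := etaMC_cmRows_of_print_of_cmRankOneBSDp_of_conjARankTwo_of_analyticMu h26 h22 h6273 hmod hGZK hKO hS28 h₄ hO10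
    hAcm2 hμcm
  -- the transfer binder, from cite facts only (Part XLVIII §141; Thm. 5.3 from Thm. 4.5 by Part LII)
  have hCL := EtaLambdaTransfer.corpuzLei2025_etaPlusMainConjecture_transfer_anMu_of_citeFacts h46
    (EtaImprimitiveTransfer.thm53_of_thm45 h45) h22 h41 hnf hGV hGVm
  by_cases hCM : V.HasCM
  · exact hcmRows V p hp5 hgood hap hns hCM
  · by_cases hcg : ∃ (V'' : WeierstrassCurve ℚ) (_ : V''.IsElliptic) (_ : V''.IsGloballyMinimal),
        V''.HasCM ∧ V''.HasGoodReductionAtPrime p ∧ V''.frobeniusTrace p = 0 ∧ ModPCongruent V'' V p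
    · obtain ⟨V'', _, _, hCM'', hgood'', hap'', hcong⟩ := hcg
      have hns'' : ¬ (∀ m : ℕ, V''.HasSurjectiveModNGaloisRep (p ^ m : ℕ)) := by
        intro h
        exact V''.not_hasSurjectiveModNGaloisRep_of_hasCM hCM'' (Fact.out) hp2 (by simpa using h 1)
      exact EtaCMCongruentTransfer.quadraticBranchPlusEtaMainConjectureAt_of_congruent_of_transfer hCL p hp5 V'' hgood'' hap''
        (hcmRows V'' p hp5 hgood'' hap'' hns'' hCM'') (hμcm V'' p hp5 hgood'' hap'' hns'' hCM'') V hgood hap hcong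
    · exact huncong V p hp5 hgood hap hns hCM hcg

/-! ## §3 The rank-≤1 face from the same inputs with the uncongruent stub restricted -/

/-- **THE RANK-≤1 FACE OF THE CRUX (the (570)(B) weak statement) FROM THE v10-SHAPE INPUTS** with the uncongruent stub restricted to the rows
with a partner of analytic rank `≤ 1` (`huncong₁`). (A) is still displayed on the CM partners of analytic rank `≥ 2` because a non-CM row
inherits the node from a congruent CM ANCHOR whose partner may have any rank; in-table every anchor of record has `r_an ≤ 1` (k8eta-c2 g8),
class-wide the binder stays. CONDITIONAL; nothing booked. [cite: Kobayashi2003, §4 + Thm. 4.1 (p. 8)] [cite: BurungaleTian2026, Thm. 2.6]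
[cite: HatleyLei2019, Thm. 4.6, Prop. 5.1] [cite: CorpuzLei2025, Thm. 4.5] [cite: KitajimaOtsuki2018, Main Thm. 1.3]
[cite: BurungaleFlach2024, Cor. 2] [cite: CoatesSujatha2005, §3 statement (A)] [cite: Miller2011LMS, Def. 1.1] -/
theorem plusEtaMainConjectureNonsurjRankLeOne_of_cmRankOneBSDp_of_conjARankTwo_of_analyticMu_of_uncongruentRankLeOne_of_citeFacts45
    (h22 : Kobayashi2003.thm22_etaSignedSelmerDual_finite_torsion)
    (h6273 : Kobayashi2003.thm62_63_73_etaColemanPoitouTate)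
    (h26 : BurungaleTian2026.thm26_etaKatoSequences_charIdeal_upToP_of_cm)
    (h46 : HatleyLei2019.thm46_prop51_etaSignedMuLambda_transfer_of_torsionIso)
    (h45 : CorpuzLei2025.thm45_etaPlusImprimitive_congruence_of_torsionIso)
    (h41 : Kobayashi2003.thm41_plusEtaCharIdeal_dvd)
    (hnf : exists_isNewformOf) (hGV : realPeriodRat_eq_unit_mul_plusPeriod)
    (hGVm : numRealComponents_mul_imaginaryPeriodRat_eq_unit_mul_minusPeriod_of_odd)
    (hmod : hasEntireLFunction_rat) (hGZK : rank_eq_analyticRank_of_analyticRank_le_one)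
    (hKO : KitajimaOtsuki2018.mainThm13_etaSignedSelmerDual_noFiniteSubmodule)
    (hS28 : bsdTriple_of_hasCM_of_L_one_ne_zero) (h₄ : PAdicGrossZagierBranch)
    (hO10 : ∀ (W : WeierstrassCurve ℚ) [W.IsElliptic] [W.IsGloballyMinimal] (p : ℕ) [Fact p.Prime],
      W.HasCM → W.analyticRank = 1 → 5 ≤ p → Addv W p → SubGss W p → MissingPPartAt W p)
    (hAcm2 : ∀ (V : WeierstrassCurve ℚ) [V.IsElliptic] [V.IsGloballyMinimal] (W : WeierstrassCurve ℚ) [W.IsElliptic]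
        [W.IsGloballyMinimal] (C : VariableChange ℚ) (p : ℕ) [Fact p.Prime],
        5 ≤ p → C • W.quadraticTwist ((-1) ^ (p / 2) * p) = V →
        V.HasGoodReductionAtPrime p → V.frobeniusTrace p = 0 →
        ¬ (∀ m : ℕ, V.HasSurjectiveModNGaloisRep (p ^ m : ℕ)) → V.HasCM → 2 ≤ W.analyticRank →
        ∀ (κ : ZpExtension ℚ p), κ.IsCyclotomic →
          ∃ (γ : absoluteGaloisGroup ℚ) (D : W.FineSelmerDualData κ γ),
            Module.Finite ℤ_[p] (RestrictScalars ℤ_[p] (IwasawaAlgebra p) D.X))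
    (hμcm : ∀ (V : WeierstrassCurve ℚ) [V.IsElliptic] [V.IsGloballyMinimal] (p : ℕ) [Fact p.Prime],
        5 ≤ p → V.HasGoodReductionAtPrime p → V.frobeniusTrace p = 0 →
        ¬ (∀ m : ℕ, V.HasSurjectiveModNGaloisRep (p ^ m : ℕ)) → V.HasCM →
        ∀ {N : ℕ} [NeZero N] {f : CuspForm (Gamma0 N) 2}, IsNewformOf V f →
          ∀ (ϖ : ℚ), (if Even (p / 2) then (ϖ : ℝ) * V.realPeriodRat = plusPeriod f
              else (ϖ : ℝ) * V.imaginaryPeriodRat = minusPeriod f) →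
          ∀ (Lη : IwasawaAlgebra p), IsQuadraticBranchPlusLFunction f p ϖ Lη → HasUnitContent Lη)
    (huncong₁ : ∀ (V : WeierstrassCurve ℚ) [V.IsElliptic] [V.IsGloballyMinimal] (p : ℕ) [Fact p.Prime],
        5 ≤ p → V.HasGoodReductionAtPrime p → V.frobeniusTrace p = 0 →
        ¬ (∀ m : ℕ, V.HasSurjectiveModNGaloisRep (p ^ m : ℕ)) → ¬ V.HasCM →
        ¬ (∃ (V'' : WeierstrassCurve ℚ) (_ : V''.IsElliptic) (_ : V''.IsGloballyMinimal),
            V''.HasCM ∧ V''.HasGoodReductionAtPrime p ∧ V''.frobeniusTrace p = 0 ∧ ModPCongruent V'' V p) →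
        (∃ (W : WeierstrassCurve ℚ) (_ : W.IsElliptic) (_ : W.IsGloballyMinimal) (C : VariableChange ℚ),
            C • W.quadraticTwist ((-1 : ℚ) ^ (p / 2) * p) = V ∧ W.analyticRank ≤ 1) →
        QuadraticBranchPlusEtaMainConjectureAt V p) :
    ∀ (V : WeierstrassCurve ℚ) [V.IsElliptic] [V.IsGloballyMinimal] (p : ℕ) [Fact p.Prime],
      5 ≤ p → V.HasGoodReductionAtPrime p → V.frobeniusTrace p = 0 →
      ¬ (∀ m : ℕ, V.HasSurjectiveModNGaloisRep (p ^ m : ℕ)) →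
      (∃ (W : WeierstrassCurve ℚ) (_ : W.IsElliptic) (_ : W.IsGloballyMinimal) (C : VariableChange ℚ),
          C • W.quadraticTwist ((-1 : ℚ) ^ (p / 2) * p) = V ∧ W.analyticRank ≤ 1) →
      QuadraticBranchPlusEtaMainConjectureAt V p := by
  intro V _ _ p _ hp5 hgood hap hns hW
  have hp2 : p ≠ 2 := by omega
  have hcmRows := etaMC_cmRows_of_print_of_cmRankOneBSDp_of_conjARankTwo_of_analyticMu h26 h22 h6273 hmod hGZK hKO hS28 h₄ hO10
    hAcm2 hμcm
  have hCL := EtaLambdaTransfer.corpuzLei2025_etaPlusMainConjecture_transfer_anMu_of_citeFacts h46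
    (EtaImprimitiveTransfer.thm53_of_thm45 h45) h22 h41 hnf hGV hGVm
  by_cases hCM : V.HasCM
  · exact hcmRows V p hp5 hgood hap hns hCM
  · by_cases hcg : ∃ (V'' : WeierstrassCurve ℚ) (_ : V''.IsElliptic) (_ : V''.IsGloballyMinimal),
        V''.HasCM ∧ V''.HasGoodReductionAtPrime p ∧ V''.frobeniusTrace p = 0 ∧ ModPCongruent V'' V p
    · obtain ⟨V'', _, _, hCM'', hgood'', hap'', hcong⟩ := hcg
      have hns'' : ¬ (∀ m : ℕ, V''.HasSurjectiveModNGaloisRep (p ^ m : ℕ)) := by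
        intro h
        exact V''.not_hasSurjectiveModNGaloisRep_of_hasCM hCM'' (Fact.out) hp2 (by simpa using h 1)
      exact EtaCMCongruentTransfer.quadraticBranchPlusEtaMainConjectureAt_of_congruent_of_transfer hCL p hp5 V'' hgood'' hap''
        (hcmRows V'' p hp5 hgood'' hap'' hns'' hCM'') (hμcm V'' p hp5 hgood'' hap'' hns'' hCM'') V hgood hap hcong
    · exact huncong₁ V p hp5 hgood hap hns hCM hcg hW

end EtaRankLeOneOfO10

end Summit.BirchSwinnertonDyer.BirchSwinnertonDyer.Theorems

end
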